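import Summits.Ventures.WeilGRH.OddCharArchCorrection
import Summits.RiemannHypothesis.RiemannHypothesis.Theorems.WeilBochnerMeasureCountingChar
import HarnessLib

/-!
# GRH arm (rh-explicit, venture WeilGRH): the Weil side of the counting law for an ODD character

Cell `rh-explicit`, WEIL TRACK (structure seat weil-3, gen8).  The even-`χ` counting law of every `χ`-rung
measure (`WeilBochnerMeasureChar.abs_measureReal_Icc_sub_le_char`, structure seat gen6) rests on two
parity-`0` inputs: the Weil-side bound `exists_weil_side_bound_char` (`|Re W_χ(g±) − θ(T)/π − (T/2π)log q|
≤ A + B log(1+T)` for Selberg's kernels) and the additivity `weilFunctionalChar_add_of_even_firstWindow`,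
both obtained by reducing `W_χ` to `ζ`'s functional on the first window.  For an ODD `χ` the reduction
carries the bounded `sech` correction of `OddCharArchCorrection.lean`
(`W_χ(k) = W(k) − (k̂(0)+k̂(1)) + k(0) log q + (1/2π)∫k̂(½+it)·π/cosh(πt)dt`, `|correction| ≤ (π/2)·sup|k̂|`),
so both inputs hold for parity `1` with the SAME main term (this file):

* `exists_weil_side_bound_char_odd` — `|Re W_χ(g±) − θ(T)/π − (T/2π) log q| ≤ A + B log(1 + T)`
  (`A` enlarged by `(π/2)·3e^{2π}`, the uniform bound `‖F±‖ ≤ 3e^{2π}` on the real line);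
* `weilFunctionalChar_add_of_odd_firstWindow` — additivity of `W_χ` on continuous first-window kernels
  with integrable archimedean integrands and bounded transforms.

The measure-side counting law for odd `χ` follows verbatim (`OddCharCountingLaw.lean`).
No definitions, no named facts, RH/GRH-free.
-/

set_option autoImplicit false

noncomputable section

open Complex Filter Set MeasureTheory
open scoped Real Topology ComplexConjugate

namespace Summit.Ventures.WeilGRH

open Literature.NumberTheory.LFunctions Literature.Analysis.Fourier Literature.Analysis.SpecialFunctions
open Summit.RiemannHypothesis.RiemannHypothesis.Theorems.WeilBochnerMeasure
open Summit.RiemannHypothesis.RiemannHypothesis.Theorems.WeilBochnerMeasureChar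

variable {q : ℕ} {χ : DirichletCharacter ℂ q}

/-! ## The odd reduction for a kernel with a real continuous bounded transform -/

/-- For an ODD `χ` mod `q ≠ 1` and a continuous first-window kernel `g` whose transform on the critical
line is a real continuous function `Φ` with `|Φ| ≤ S` and `|Φ(u)| ≤ M/(1+u²)`:
`Re W_χ(g) = Re W(g) − Re(ĝ(0)+ĝ(1)) + Re(g(0) log q) + c` with `|c| ≤ (π/2)·S`. -/
theorem re_weilFunctionalChar_odd_eq (hq : q ≠ 1) (hχ : charParity χ = 1) {g : ℝ → ℂ}
    (hg : Continuous g) (hgs : tsupport g ⊆ Icc (-Real.log 2) (Real.log 2)) {Φ : ℝ → ℝ}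
    (hΦc : Continuous Φ) (hΦ : ∀ u : ℝ, weilMellin g (1 / 2 + u * I) = (Φ u : ℂ))
    {M S : ℝ} (hM : ∀ u : ℝ, ‖weilMellin g (1 / 2 + u * I)‖ ≤ M / (1 + u ^ 2))
    (hS : ∀ u : ℝ, ‖weilMellin g (1 / 2 + u * I)‖ ≤ S) :
    ∃ c : ℝ, |c| ≤ π / 2 * S ∧
      (weilFunctionalChar χ g).re =
        (weilFunctional g).re - (weilPolarTerm g).re + (g 0 * (Real.log q : ℂ)).re + c := by
  have hgcs : HasCompactSupport g := isCompact_Icc.of_isClosed_subset (isClosed_tsupport _) hgs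
  have h0 := integrable_arch_of_decay hg hgcs hM
  have hmeas : AEStronglyMeasurable fun t : ℝ ↦ weilMellin g (1 / 2 + t * I) := by
    rw [show (fun t : ℝ ↦ weilMellin g (1 / 2 + t * I)) = fun t ↦ ((Φ t : ℝ) : ℂ) from funext hΦ]
    exact (Complex.continuous_ofReal.comp hΦc).aestronglyMeasurable
  have hD := integrable_parityCorrection hmeas hS
  have hid := weilFunctionalChar_odd_eq_sub_polar_add hq hχ hg hgs h0 hD
  have hcorr := norm_parityCorrection_le hS
  refine ⟨((1 / (2 * π) : ℂ) * ∫ t : ℝ, weilMellin g (1 / 2 + t * I) *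
      ((π / Real.cosh (π * t) : ℝ) : ℂ)).re, ?_, ?_⟩
  · exact (Complex.abs_re_le_norm _).trans hcorr
  · rw [hid]
    simp only [Complex.add_re, Complex.sub_re]

/-! ## The Weil side of the counting law for odd `χ` -/

/-- **The Weil side of the counting law for an odd `χ`**: for Selberg's kernels `g±` of bandwidth `Δ`
(`2πΔ ≤ log 2`), `|Re W_χ(g±) − θ(T)/π − (T/2π) log q| ≤ A + B log(1+T)` with `A, B` independent of
`T ≥ 0` — the even bound `exists_weil_side_bound_char` plus the `sech` correction `≤ (π/2)·3e^{2π}`. -/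
theorem exists_weil_side_bound_char_odd (hq : q ≠ 1) (hχ : charParity χ = 1) {Δ : ℝ} (hΔ0 : 0 < Δ)
    (hΔ2 : 2 * π * Δ ≤ Real.log 2) :
    ∃ A B : ℝ, ∀ T : ℝ, 0 ≤ T → ∀ g : ℝ → ℂ, Continuous g →
      tsupport g ⊆ Icc (-(2 * π * Δ)) (2 * π * Δ) →
      ((∀ z : ℂ, weilMellin g (1 / 2 + z * I) = selbergMajorant Δ 0 T z) ∧
          g 0 = ((T / (2 * π) + 1 / (2 * π * Δ) : ℝ) : ℂ) ∨
        (∀ z : ℂ, weilMellin g (1 / 2 + z * I) = selbergMinorant Δ 0 T z) ∧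
          g 0 = ((T / (2 * π) + -(1 / (2 * π * Δ)) : ℝ) : ℂ)) →
      |(weilFunctionalChar χ g).re - (riemannSiegelTheta T / π + T / (2 * π) * Real.log q)| ≤
        A + B * Real.log (1 + T) := by
  obtain ⟨A, B, hAB⟩ := exists_weil_side_bound hΔ0 hΔ2
  set P : ℝ := 3 * Real.exp (2 * π) * Real.exp (2 * π * Δ) with hP
  set S : ℝ := 3 * Real.exp (2 * π) with hSdef
  refine ⟨A + 2 * P + 1 / (2 * π * Δ) * Real.log q + π / 2 * S, B, ?_⟩
  intro T hT g hg hgs hcase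
  have hζ := hAB T hT g hg hgs hcase
  have hgs' : tsupport g ⊆ Icc (-Real.log 2) (Real.log 2) :=
    hgs.trans (Icc_subset_Icc (by linarith) hΔ2)
  -- the polar points `s = 0, 1` are `1/2 + zi` with `z = ± i/2`
  have e0 : (1 : ℂ) / 2 + I / 2 * I = 0 := by linear_combination Complex.I_mul_I / 2
  have e1 : (1 : ℂ) / 2 + -I / 2 * I = 1 := by linear_combination -Complex.I_mul_I / 2
  have hexp : ∀ z : ℂ, |z.im| ≤ 1 →
      3 * Real.exp (2 * π) * Real.exp (2 * π * Δ * |z.im|) ≤ P := by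
    intro z hz
    rw [hP]
    refine mul_le_mul_of_nonneg_left (Real.exp_le_exp.2 ?_) (by positivity)
    exact mul_le_of_le_one_right (by positivity) hz
  have hmel : ∀ z : ℂ, ‖weilMellin g (1 / 2 + z * I)‖ ≤
      3 * Real.exp (2 * π) * Real.exp (2 * π * Δ * |z.im|) := by
    intro z
    rcases hcase with ⟨hm, -⟩ | ⟨hm, -⟩
    · rw [hm]; exact norm_selbergMajorant_le hΔ0 0 T z
    · rw [hm]; exact norm_selbergMinorant_le hΔ0 0 T z
  have hP0 : ‖weilMellin g 0‖ ≤ P := by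
    rw [← e0]; exact (hmel _).trans (hexp _ (by norm_num))
  have hP1 : ‖weilMellin g 1‖ ≤ P := by
    rw [← e1]; exact (hmel _).trans (hexp _ (by norm_num))
  have hpolar : |(weilPolarTerm g).re| ≤ 2 * P := by
    rw [weilPolarTerm, Complex.add_re]
    calc |(weilMellin g 0).re + (weilMellin g 1).re|
        ≤ |(weilMellin g 0).re| + |(weilMellin g 1).re| := abs_add_le _ _
      _ ≤ ‖weilMellin g 0‖ + ‖weilMellin g 1‖ :=
          add_le_add (Complex.abs_re_le_norm _) (Complex.abs_re_le_norm _)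
      _ ≤ 2 * P := by linarith
  -- the uniform bound on the real line and the quadratic decay
  have hS : ∀ u : ℝ, ‖weilMellin g (1 / 2 + u * I)‖ ≤ S := by
    intro u
    have h := hmel u
    simp only [Complex.ofReal_im, abs_zero, mul_zero, Real.exp_zero, mul_one] at h
    exact h
  -- real continuous transform + decay, by cases
  obtain ⟨c, hc, hid⟩ : ∃ c : ℝ, |c| ≤ π / 2 * S ∧
      (weilFunctionalChar χ g).re =
        (weilFunctional g).re - (weilPolarTerm g).re + (g 0 * (Real.log q : ℂ)).re + c := by
    rcases hcase with ⟨hm, -⟩ | ⟨hm, -⟩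
    · obtain ⟨K, hK0, hK⟩ := exists_norm_selbergMajorant_le hΔ0 0 T
      refine re_weilFunctionalChar_odd_eq hq hχ hg hgs' (continuous_selbergMajorantReal Δ 0 T)
        (fun u ↦ by rw [hm, selbergMajorant_ofReal]) (M := K * (1 + 2 * (1 + T ^ 2))) (fun u ↦ ?_) hS
      rw [hm]
      have h := hK u
      simp only [Complex.ofReal_im, abs_zero, mul_zero, Real.exp_zero, mul_one, Complex.ofReal_re] at h
      exact h.trans (profile_le_div hK0.le)
    · obtain ⟨K, hK0, hK⟩ := exists_norm_selbergMinorant_le hΔ0 0 T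
      refine re_weilFunctionalChar_odd_eq hq hχ hg hgs' (continuous_selbergMinorantReal Δ 0 T)
        (fun u ↦ by rw [hm, selbergMinorant_ofReal]) (M := K * (1 + 2 * (1 + T ^ 2))) (fun u ↦ ?_) hS
      rw [hm]
      have h := hK u
      simp only [Complex.ofReal_im, abs_zero, mul_zero, Real.exp_zero, mul_one, Complex.ofReal_re] at h
      exact h.trans (profile_le_div hK0.le)
  -- `g(0) log q`
  have hlogq : 0 ≤ Real.log q := Real.log_natCast_nonneg q
  have hg0 : |(g 0 * (Real.log q : ℂ)).re - T / (2 * π) * Real.log q| ≤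
      1 / (2 * π * Δ) * Real.log q := by
    have hΔ' : 0 ≤ 1 / (2 * π * Δ) := by positivity
    rcases hcase with ⟨-, h0⟩ | ⟨-, h0⟩
    · rw [h0, ← Complex.ofReal_mul, Complex.ofReal_re]
      rw [show (T / (2 * π) + 1 / (2 * π * Δ)) * Real.log q - T / (2 * π) * Real.log q =
        1 / (2 * π * Δ) * Real.log q by ring]
      exact le_of_eq (abs_of_nonneg (mul_nonneg hΔ' hlogq))
    · rw [h0, ← Complex.ofReal_mul, Complex.ofReal_re]
      rw [show (T / (2 * π) + -(1 / (2 * π * Δ))) * Real.log q - T / (2 * π) * Real.log q =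
        -(1 / (2 * π * Δ) * Real.log q) by ring, abs_neg]
      exact le_of_eq (abs_of_nonneg (mul_nonneg hΔ' hlogq))
  rw [hid]
  rw [abs_le] at hζ hpolar hg0 hc ⊢
  constructor <;> linarith [hζ.1, hζ.2, hpolar.1, hpolar.2, hg0.1, hg0.2, hc.1, hc.2]

/-! ## Additivity of `W_χ` for odd `χ` on first-window kernels -/

/-- Additivity of `W_χ` (odd `χ` mod `q ≠ 1`) on continuous kernels of the first window with integrable
archimedean integrands and bounded measurable transforms (the odd reduction
`weilFunctionalChar_odd_eq_sub_polar_add` + additivity of `W`, of the polar term and of the `sech`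
correction). -/
theorem weilFunctionalChar_add_of_odd_firstWindow (hq : q ≠ 1) (hχ : charParity χ = 1) {g h : ℝ → ℂ}
    (hgc : Continuous g) (hgs : tsupport g ⊆ Icc (-Real.log 2) (Real.log 2))
    (hhc : Continuous h) (hhs : tsupport h ⊆ Icc (-Real.log 2) (Real.log 2))
    (hgA : Integrable fun t : ℝ ↦
      weilMellin g (1 / 2 + t * I) * ((Complex.digamma (1 / 4 + t / 2 * I)).re : ℂ))
    (hhA : Integrable fun t : ℝ ↦
      weilMellin h (1 / 2 + t * I) * ((Complex.digamma (1 / 4 + t / 2 * I)).re : ℂ))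
    (hgD : Integrable fun t : ℝ ↦ weilMellin g (1 / 2 + t * I) * ((π / Real.cosh (π * t) : ℝ) : ℂ))
    (hhD : Integrable fun t : ℝ ↦ weilMellin h (1 / 2 + t * I) * ((π / Real.cosh (π * t) : ℝ) : ℂ)) :
    weilFunctionalChar χ (g + h) = weilFunctionalChar χ g + weilFunctionalChar χ h := by
  have hgcs : HasCompactSupport g := isCompact_Icc.of_isClosed_subset (isClosed_tsupport _) hgs
  have hhcs : HasCompactSupport h := isCompact_Icc.of_isClosed_subset (isClosed_tsupport _) hhs
  have hsum : tsupport (g + h) ⊆ Icc (-Real.log 2) (Real.log 2) := by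
    refine closure_minimal (fun x hx ↦ ?_) isClosed_Icc
    rw [Function.mem_support] at hx
    by_contra hxc
    have h1 : g x = 0 := image_eq_zero_of_notMem_tsupport fun h' ↦ hxc (hgs h')
    have h2 : h x = 0 := image_eq_zero_of_notMem_tsupport fun h' ↦ hxc (hhs h')
    exact hx (by simp only [Pi.add_apply, h1, h2, add_zero])
  have hadd : ∀ t : ℝ, weilMellin (g + h) (1 / 2 + t * I) =
      weilMellin g (1 / 2 + t * I) + weilMellin h (1 / 2 + t * I) :=
    fun t ↦ weilMellin_add hgc hgcs hhc hhcs _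
  have hsA : Integrable fun t : ℝ ↦
      weilMellin (g + h) (1 / 2 + t * I) * ((Complex.digamma (1 / 4 + t / 2 * I)).re : ℂ) :=
    (hgA.add hhA).congr (Eventually.of_forall fun t ↦ by simp only [Pi.add_apply, hadd t]; ring)
  have hsD : Integrable fun t : ℝ ↦
      weilMellin (g + h) (1 / 2 + t * I) * ((π / Real.cosh (π * t) : ℝ) : ℂ) :=
    (hgD.add hhD).congr (Eventually.of_forall fun t ↦ by simp only [Pi.add_apply, hadd t]; ring)
  have hint : ∫ t : ℝ, weilMellin (g + h) (1 / 2 + t * I) * ((π / Real.cosh (π * t) : ℝ) : ℂ) =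
      (∫ t : ℝ, weilMellin g (1 / 2 + t * I) * ((π / Real.cosh (π * t) : ℝ) : ℂ)) +
        ∫ t : ℝ, weilMellin h (1 / 2 + t * I) * ((π / Real.cosh (π * t) : ℝ) : ℂ) := by
    rw [← integral_add hgD hhD]
    exact integral_congr_ae (Eventually.of_forall fun t ↦ by simp only [hadd t]; ring)
  rw [weilFunctionalChar_odd_eq_sub_polar_add hq hχ (hgc.add hhc) hsum hsA hsD,
    weilFunctionalChar_odd_eq_sub_polar_add hq hχ hgc hgs hgA hgD,
    weilFunctionalChar_odd_eq_sub_polar_add hq hχ hhc hhs hhA hhD,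
    weilFunctional_add_of_continuous hgc hgcs hhc hhcs hgA hhA,
    weilPolarTerm_add hgc hgcs hhc hhcs, hint, Pi.add_apply]
  ring

end Summit.Ventures.WeilGRH

end
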